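import Literature.Probability.RandomPlanarGeometry.RestrictionSides
import Literature.Probability.RandomPlanarGeometry.HullApproximationProofs
import Literature.Probability.RandomPlanarGeometry.ConformalRestrictionProofs
import Literature.Probability.RandomPlanarGeometry.RestrictionMapProofs
import Literature.Probability.RandomPlanarGeometry.ArcApproximation

/-!
# Avoidance determines the law (stmt-CriticalPhenomena-1373): one-sided arc hulls, both sides

Landing target:
`Summits/CriticalPhenomena/SAWScalingLimit/Theorems/SAWLoopFugacityFlowAvoidanceDeterminesLawHulls.lean`
(`--supports stmt-CriticalPhenomena-1373`).

Half-plane bookkeeping for the proof of `AvoidanceDeterminesLaw` (no new definitions; the real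
segments `[-R, -c]`, `[c, R]` are written as images `((↑) : ℝ → ℂ) '' Icc _ _`):

* `subset_leftDomain_of_isMinusHull` — a `−`-hull avoided by a configuration `K` lies in
  the left domain of `K` (mirror of `RestrictionConfig.subset_rightDomain_of_disjoint`);
* `exists_isArcHull_subset_of_isPlusHull`, `exists_isArcHull_subset_of_isMinusHull` — **tight smooth
  outer approximation**: a nonempty `±`-hull `A` whose points have modulus in `[c, R]` is
  contained in a smooth `±`-hull `J` (an arc hull) with `A ∩ ℍ` interior to `J` and `J` inside
  any prescribed open neighbourhood of `A ∪ [c, R]` (resp. `A ∪ [-R, -c]`): the hulls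
  `E_n(A)` of [LSW] Lemma 2.1 (`IsPlusHull.arcHull`, `HullApproximationProofs`) decrease to
  `realFill A`, and the `−` case follows by the reflection `σ(z) = -z̄`;
* `exists_isArcHull_image_subset` — the same for the image `E(X)` of a set `X` with real points in
  `[c, R]` under the symmetric extension `E` of a one-sided restriction map (`HullUniformizer`),
  inside `E(W)` for an open `W ⊇ X ∪ [c, R]` (`E` is increasing on `[0, R + 1]`);
* `exists_subset_of_antitone_isCompact` — a decreasing sequence of compact sets is eventually
  inside any open set containing its intersection;
* `isHullSubdomain_trans` — hull subdomains of hull subdomains are hull subdomains.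
-/

noncomputable section

open scoped Topology
open Filter Set Metric Bornology
open Literature.Probability.RandomPlanarGeometry
open UpperHalfPlane (upperHalfPlaneSet isOpen_upperHalfPlaneSet)

namespace Summit.CriticalPhenomena.SAWScalingLimit.Theorems.AvoidanceDeterminesLaw

/-! ### Decreasing compact sets enter any neighbourhood of their intersection -/

/-- A decreasing sequence of compact sets is eventually inside any open set containing its
intersection. [folklore] -/
theorem exists_subset_of_antitone_isCompact {J : ℕ → Set ℂ} (hanti : Antitone J)
    (hcpt : ∀ n, IsCompact (J n)) {U : Set ℂ} (hU : IsOpen U) (hsub : (⋂ n, J n) ⊆ U) :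
    ∃ n, J n ⊆ U := by
  have hdir : Directed (· ⊇ ·) J := fun m n ↦ ⟨max m n, hanti (le_max_left m n), hanti (le_max_right m n)⟩
  exact exists_subset_nhds_of_isCompact' hdir hcpt (fun n ↦ (hcpt n).isClosed)
    (fun x hx ↦ hU.mem_nhds (hsub hx))

/-! ### Real fillings of one-sided hulls with moduli in `[c, R]` -/

/-- **Real filling of a `+`-hull with moduli in `[c, R]`**: if every point of `A` has norm in
`[c, R]`, the real trace of `A` is nonempty and all real points of `A` are positive, then
`realFill A ⊆ A ∪ [c, R]`. [folklore] -/
theorem realFill_subset_union_Icc {A : Set ℂ} {c R : ℝ}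
    (hnorm : ∀ z ∈ A, c ≤ ‖z‖ ∧ ‖z‖ ≤ R) (hne : (realTrace A).Nonempty)
    (hpos : ∀ x : ℝ, (x : ℂ) ∈ A → 0 < x) :
    realFill A ⊆ A ∪ ((↑) : ℝ → ℂ) '' Icc c R := by
  rintro z (hz | ⟨x, hx, rfl⟩)
  · exact Or.inl hz
  · right
    have hlo : ∀ y ∈ realTrace A, c ≤ |y| ∧ |y| ≤ R := fun y hy ↦ by
      have := hnorm _ hy
      rwa [Complex.norm_real, Real.norm_eq_abs] at this
    have h1 : c ≤ sInf (realTrace A) := le_csInf hne fun y hy ↦ by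
      have := (hlo y hy).1; rwa [abs_of_pos (hpos y hy)] at this
    have h2 : sSup (realTrace A) ≤ R := csSup_le hne fun y hy ↦ by
      have := (hlo y hy).2; rwa [abs_of_pos (hpos y hy)] at this
    exact ⟨x, ⟨h1.trans hx.1, hx.2.trans h2⟩, rfl⟩

/-- The reflection `σ(z) = -z̄` maps the real segment `[c, R]` onto `[-R, -c]`. [folklore] -/
theorem imagAxisRefl_image_ofReal_Icc (c R : ℝ) :
    imagAxisRefl '' (((↑) : ℝ → ℂ) '' Icc c R) = ((↑) : ℝ → ℂ) '' Icc (-R) (-c) := by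
  ext z
  constructor
  · rintro ⟨_, ⟨x, hx, rfl⟩, rfl⟩
    rw [imagAxisRefl_ofReal]
    exact ⟨-x, ⟨by linarith [hx.2], by linarith [hx.1]⟩, rfl⟩
  · rintro ⟨x, hx, rfl⟩
    refine ⟨((-x : ℝ) : ℂ), ⟨-x, ⟨by linarith [hx.2], by linarith [hx.1]⟩, rfl⟩, ?_⟩
    rw [imagAxisRefl_ofReal, neg_neg]

/-! ### Tight smooth outer approximation of `+`-hulls -/

/-- **A `+`-hull in a tight smooth `+`-hull.** Let `A` be a nonempty `+`-hull and `U` an open set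
containing `realFill A = A ∪ [x₀, x₁]`. Then some smooth `+`-hull `J` (an arc hull) contains `A`,
is contained in `U`, and has every point of `A ∩ ℍ` in its interior: one of the hulls `E_n(A)` of
[LSW] Lemma 2.1, which decrease to `realFill A`.
[cite: LawlerSchrammWerner2003Restriction, Lemma 2.1 and its proof (p. 8)] -/
theorem exists_isArcHull_subset_of_realFill
    {A : Set ℂ} (hA : IsPlusHull A) (hne : A.Nonempty) {U : Set ℂ} (hU : IsOpen U)
    (hAU : realFill A ⊆ U) :
    ∃ J : Set ℂ, IsArcHull J ∧ IsPlusHull J ∧ A ⊆ J ∧ J ⊆ U ∧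
      ∀ z ∈ A, 0 < z.im → z ∈ interior J := by
  have hsub : (⋂ n, hA.arcHull hne n) ⊆ U := by rw [hA.iInter_arcHull hne]; exact hAU
  obtain ⟨n, hn⟩ := exists_subset_of_antitone_isCompact (hA.antitone_arcHull hne)
    (fun n ↦ (hA.isStarHull_arcHull hne n).isBoundedHull.isCompact) hU hsub
  exact ⟨hA.arcHull hne n, hA.isArcHull_arcHull hne n, hA.isPlusHull_arcHull hne n,
    hA.subset_arcHull hne n, hn, fun z hzA hz ↦ hA.mem_interior_arcHull hne n hzA hz⟩

/-- **A `+`-hull with moduli in `[c, R]` in a tight smooth `+`-hull**: as above, with `U` an open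
set containing `A ∪ [c, R] ⊇ realFill A`. [cite: LawlerSchrammWerner2003Restriction, Lemma 2.1 (p. 8)] -/
theorem exists_isArcHull_subset_of_isPlusHull {A : Set ℂ}
    (hA : IsPlusHull A) (hne : A.Nonempty) {c R : ℝ} (hnorm : ∀ z ∈ A, c ≤ ‖z‖ ∧ ‖z‖ ≤ R)
    {U : Set ℂ} (hU : IsOpen U) (hAU : A ∪ ((↑) : ℝ → ℂ) '' Icc c R ⊆ U) :
    ∃ J : Set ℂ, IsArcHull J ∧ IsPlusHull J ∧ A ⊆ J ∧ J ⊆ U ∧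
      ∀ z ∈ A, 0 < z.im → z ∈ interior J :=
  exists_isArcHull_subset_of_realFill hA hne hU
    ((realFill_subset_union_Icc hnorm (hA.1.isBoundedHull.realTrace_nonempty hne) hA.2).trans hAU)

/-- **A `−`-hull in a tight smooth `−`-hull** (by the reflection `σ(z) = -z̄`): for a nonempty
`−`-hull `A` whose points have norm in `[c, R]` and an open `U ⊇ A ∪ [-R, -c]`, some smooth
`−`-hull `J ⊆ U` contains `A`, with every point of `A ∩ ℍ` interior.
[cite: LawlerSchrammWerner2003Restriction, Lemma 2.1 (p. 8) with §2 p. 8 (𝒬₋ = σ(𝒬₊))] -/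
theorem exists_isArcHull_subset_of_isMinusHull {A : Set ℂ}
    (hA : IsMinusHull A) (hne : A.Nonempty) {c R : ℝ} (hnorm : ∀ z ∈ A, c ≤ ‖z‖ ∧ ‖z‖ ≤ R)
    {U : Set ℂ} (hU : IsOpen U) (hAU : A ∪ ((↑) : ℝ → ℂ) '' Icc (-R) (-c) ⊆ U) :
    ∃ J : Set ℂ, IsArcHull J ∧ IsMinusHull J ∧ A ⊆ J ∧ J ⊆ U ∧
      ∀ z ∈ A, 0 < z.im → z ∈ interior J := by
  have hA' : IsPlusHull (imagAxisRefl '' A) := hA.image_imagAxisRefl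
  have hne' : (imagAxisRefl '' A).Nonempty := hne.image _
  have hnorm' : ∀ z ∈ imagAxisRefl '' A, c ≤ ‖z‖ ∧ ‖z‖ ≤ R := by
    rintro _ ⟨w, hw, rfl⟩
    rw [norm_imagAxisRefl]
    exact hnorm w hw
  have hU' : IsOpen (imagAxisRefl '' U) := imagAxisRefl.isOpenMap U hU
  have hAU' : imagAxisRefl '' A ∪ ((↑) : ℝ → ℂ) '' Icc c R ⊆ imagAxisRefl '' U := by
    have : imagAxisRefl '' A ∪ ((↑) : ℝ → ℂ) '' Icc c R =
        imagAxisRefl '' (A ∪ ((↑) : ℝ → ℂ) '' Icc (-R) (-c)) := by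
      rw [image_union, ← imagAxisRefl_image_image (((↑) : ℝ → ℂ) '' Icc c R),
        imagAxisRefl_image_ofReal_Icc]
    rw [this]
    exact image_mono hAU
  obtain ⟨J, hJa, hJp, hAJ, hJU, hint⟩ := exists_isArcHull_subset_of_isPlusHull hA' hne' hnorm' hU' hAU'
  refine ⟨imagAxisRefl '' J, hJa.image_imagAxisRefl, hJp.image_imagAxisRefl, ?_, ?_, ?_⟩
  · intro z hz
    exact ⟨imagAxisRefl z, hAJ (mem_image_of_mem _ hz), by simp⟩
  · calc imagAxisRefl '' J ⊆ imagAxisRefl '' (imagAxisRefl '' U) := image_mono hJU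
      _ = U := imagAxisRefl_image_image U
  · intro z hzA hz
    have h := hint (imagAxisRefl z) (mem_image_of_mem imagAxisRefl hzA) (by simpa using hz)
    rw [← imagAxisRefl.image_interior]
    exact ⟨imagAxisRefl z, h, by simp⟩

/-! ### The `+`-step in the coordinates of the symmetric extension `E` -/

/-- **The transported `+`-hull in a tight smooth `+`-hull.** Let `h : IsSlitHull Y p q` be
one-sided data with negative slit (`max p q < 0`), `E = h.ext` its symmetric extension, and
`X ⊆ Ω` a set whose real points lie in `[c, R]` (`0 < c ≤ R`) with `B = E(X)` a nonempty
`+`-hull. If the open set `W ⊆ Ω` contains `X` and the real segment `[c, R]`, then some smooth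
`+`-hull `J` satisfies `B ⊆ J ⊆ E(W)`, with every point of `B ∩ ℍ` interior to `J`: `E` is an
increasing homeomorphism on `[0, R + 1]`, so `realFill B ⊆ E(X ∪ [c, R]) ⊆ E(W)`, which is open.
[folklore] -/
theorem exists_isArcHull_image_subset {Y X W : Set ℂ} {p q c R : ℝ} (h : IsSlitHull Y p q)
    (hneg : max p q < 0) (hXΩ : X ⊆ slitDomain Y p q) (hB : IsPlusHull (h.ext '' X))
    (hBne : (h.ext '' X).Nonempty) (hc : 0 < c) (hcR : c ≤ R)
    (hXreal : ∀ x : ℝ, (x : ℂ) ∈ X → c ≤ x ∧ x ≤ R) (hWo : IsOpen W)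
    (hWΩ : W ⊆ slitDomain Y p q) (hXW : X ⊆ W) (hsegW : ((↑) : ℝ → ℂ) '' Icc c R ⊆ W) :
    ∃ J : Set ℂ, IsArcHull J ∧ IsPlusHull J ∧ h.ext '' X ⊆ J ∧ J ⊆ h.ext '' W ∧
      ∀ w ∈ h.ext '' X, 0 < w.im → w ∈ interior J := by
  classical
  set f : ℝ → ℝ := h.extRe with hf
  have hreal : ∀ {x : ℝ}, 0 ≤ x → ((x : ℂ) ∈ slitDomain Y p q) := fun hx ↦
    h.ofReal_mem_slitDomain_of_pos hneg hx
  have hfeq : ∀ {x : ℝ}, 0 ≤ x → h.ext x = (f x : ℂ) := fun hx ↦ h.ext_ofReal_eq (hreal hx)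
  have hf0 : f 0 = 0 := by
    have := hfeq le_rfl
    rw [Complex.ofReal_zero, h.ext_zero] at this
    exact_mod_cast this.symm
  -- `f` is continuous, injective, hence increasing on `[0, R + 1]`
  have hR1 : (0 : ℝ) ≤ R + 1 := by linarith
  have hcont : ContinuousOn f (Icc 0 (R + 1)) := fun x hx ↦
    (h.continuousAt_extRe (hreal hx.1)).continuousWithinAt
  have hinj : InjOn f (Icc 0 (R + 1)) := by
    intro x hx x' hx' hxx'
    have : h.ext x = h.ext x' := by rw [hfeq hx.1, hfeq hx'.1, hxx']
    exact_mod_cast h.injOn_ext (hreal hx.1) (hreal hx'.1) this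
  have hfR1 : f 0 ≤ f (R + 1) := by
    rw [hf0]
    have := h.ext_ofReal_re_pos hneg (show (0 : ℝ) < R + 1 by linarith)
    rw [hfeq hR1, Complex.ofReal_re] at this
    exact this.le
  have hmono : MonotoneOn f (Icc 0 (R + 1)) :=
    (hcont.strictMonoOn_of_injOn_Icc hR1 hfR1 hinj).monotoneOn
  have hcI : c ∈ Icc 0 (R + 1) := ⟨hc.le, by linarith⟩
  have hRI : R ∈ Icc 0 (R + 1) := ⟨hc.le.trans hcR, by linarith⟩
  -- the real trace of `B`
  set B : Set ℂ := h.ext '' X with hBdef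
  have hrt : ∀ y ∈ realTrace B, ∃ x ∈ Icc c R, f x = y := by
    rintro y ⟨a, haX, hay⟩
    have haΩ := hXΩ haX
    have haim : a.im = 0 := h.im_eq_zero_of_ext_im_eq_zero haΩ (by rw [hay, Complex.ofReal_im])
    have hare : ((a.re : ℝ) : ℂ) = a := Complex.ext (by simp) (by simp [haim])
    rw [← hare] at haX hay
    have hx := hXreal a.re haX
    refine ⟨a.re, hx, ?_⟩
    have := hfeq (hc.le.trans hx.1)
    rw [hay] at this
    exact_mod_cast this.symm
  have hrtne : (realTrace B).Nonempty := hB.1.isBoundedHull.realTrace_nonempty hBne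
  have hlow : f c ≤ sInf (realTrace B) := le_csInf hrtne fun y hy ↦ by
    obtain ⟨x, hx, rfl⟩ := hrt y hy
    exact hmono hcI ⟨hc.le.trans hx.1, by linarith [hx.2]⟩ hx.1
  have hup : sSup (realTrace B) ≤ f R := csSup_le hrtne fun y hy ↦ by
    obtain ⟨x, hx, rfl⟩ := hrt y hy
    exact hmono ⟨hc.le.trans hx.1, by linarith [hx.2]⟩ hRI hx.2
  -- `realFill B ⊆ E(W)`
  set V : Set ℂ := h.ext '' W with hVdef
  have hVo : IsOpen V := Complex.isOpen_image_of_deriv_ne_zero hWo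
    (h.differentiableOn_ext.mono hWΩ) fun z hz ↦ h.deriv_ext_ne_zero (hWΩ hz)
  have hfill : realFill B ⊆ V := by
    rintro w (hw | ⟨y, hy, rfl⟩)
    · obtain ⟨a, ha, rfl⟩ := hw
      exact ⟨a, hXW ha, rfl⟩
    · have hy' : y ∈ Icc (f c) (f R) := ⟨hlow.trans hy.1, hy.2.trans hup⟩
      obtain ⟨x, hx, hxy⟩ := intermediate_value_Icc hcR (hcont.mono (Icc_subset_Icc hc.le (by linarith))) hy'
      refine ⟨x, hsegW ⟨x, hx, rfl⟩, ?_⟩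
      rw [hfeq (hc.le.trans hx.1), hxy]
  obtain ⟨J, hJa, hJp, hBJ, hJV, hint⟩ := exists_isArcHull_subset_of_realFill hB hBne hVo hfill
  exact ⟨J, hJa, hJp, hBJ, hJV, fun w hw hwim ↦ hint w hw hwim⟩

/-! ### `−`-hulls avoided by a configuration lie in its left domain -/

/-- **A `−`-hull together with the negative real axis is connected** (reflection of
`IsPlusHull.isPreconnected_union_ofReal_Ioi`). [folklore] -/
theorem isPreconnected_union_ofReal_Iio_of_isMinusHull
    {A : Set ℂ} (hA : IsMinusHull A) : IsPreconnected (A ∪ ((↑) : ℝ → ℂ) '' Iio 0) := by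
  have h := (hA.image_imagAxisRefl).isPreconnected_union_ofReal_Ioi.image _
    imagAxisRefl.continuous.continuousOn
  have heq : imagAxisRefl '' (imagAxisRefl '' A ∪ ((↑) : ℝ → ℂ) '' Ioi 0) =
      A ∪ ((↑) : ℝ → ℂ) '' Iio 0 := by
    rw [image_union, imagAxisRefl_image_image]
    congr 1
    ext z
    constructor
    · rintro ⟨_, ⟨x, hx, rfl⟩, rfl⟩
      rw [imagAxisRefl_ofReal]
      exact ⟨-x, by simpa using hx, rfl⟩
    · rintro ⟨x, hx, rfl⟩
      refine ⟨((-x : ℝ) : ℂ), ⟨-x, by simpa using hx, rfl⟩, ?_⟩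
      rw [imagAxisRefl_ofReal, neg_neg]
  rwa [heq] at h

/-- **A `−`-hull avoided by `K` lies in the left domain** (mirror of
`RestrictionConfig.subset_rightDomain_of_disjoint`). [folklore] -/
theorem subset_leftDomain_of_isMinusHull
    {A : Set ℂ} (hA : IsMinusHull A) (K : RestrictionConfig) (hKA : Disjoint (K : Set ℂ) A) :
    A ⊆ K.leftDomain := by
  have hsub : A ∪ ((↑) : ℝ → ℂ) '' Iio 0 ⊆ K.mirrorClosureᶜ := by
    rintro z (hz | ⟨x, hx, rfl⟩)
    · rw [mem_compl_iff, K.mem_mirrorClosure_iff_of_im_nonneg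
        (RestrictionConfig.im_nonneg_of_mem_isBoundedHull hA.1.isBoundedHull hz)]
      exact fun h ↦ Set.disjoint_left.1 (K.disjoint_closure_of_disjoint hA.1.zero_notMem hKA) h hz
    · exact K.ofReal_notMem_mirrorClosure (ne_of_lt hx)
  have h1 : (-1 : ℂ) ∈ A ∪ ((↑) : ℝ → ℂ) '' Iio 0 :=
    Or.inr ⟨-1, by norm_num, by simp⟩
  exact subset_union_left.trans ((isPreconnected_union_ofReal_Iio_of_isMinusHull hA).subset_connectedComponentIn h1 hsub)

/-! ### Hull subdomains of hull subdomains -/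

/-- **Transitivity of hull subdomains**: a hull subdomain `D''` of a hull subdomain `D'` of `D` is
a hull subdomain of `D`. [folklore] -/
theorem isHullSubdomain_trans
    {D D' D'' : MarkedDomain 2} (h : D.IsHullSubdomain D') (h' : D'.IsHullSubdomain D'') :
    D.IsHullSubdomain D'' := by
  have hsplit : D.carrier \ D''.carrier ⊆ (D.carrier \ D'.carrier) ∪ (D'.carrier \ D''.carrier) := by
    intro z hz
    by_cases hz' : z ∈ D'.carrier
    · exact Or.inr ⟨hz', hz.2⟩
    · exact Or.inl ⟨hz.1, hz'⟩
  have hcl : closure (D.carrier \ D''.carrier) ⊆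
      closure (D.carrier \ D'.carrier) ∪ closure (D'.carrier \ D''.carrier) := by
    rw [← closure_union]; exact closure_mono hsplit
  refine ⟨h'.carrier_subset.trans h.carrier_subset, h'.pt_zero_eq.trans h.pt_zero_eq,
    h'.pt_one_eq.trans h.pt_one_eq, fun hmem ↦ ?_, fun hmem ↦ ?_⟩
  · rcases hcl hmem with h1 | h1
    · exact h.pt_zero_notMem h1
    · exact h'.pt_zero_notMem (h.pt_zero_eq ▸ h1)
  · rcases hcl hmem with h1 | h1
    · exact h.pt_one_notMem h1
    · exact h'.pt_one_notMem (h.pt_one_eq ▸ h1)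

end Summit.CriticalPhenomena.SAWScalingLimit.Theorems.AvoidanceDeterminesLaw

end
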